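import Summits.BirchSwinnertonDyer.BirchSwinnertonDyer.Theorems.CongruentShaFreeCutBDPUpToRigidity
import Summits.BirchSwinnertonDyer.BirchSwinnertonDyer.Theorems.CongruentShaFreeCutCharacterSupply
import HarnessLib

set_option linter.dupNamespace false -- `Summit.BirchSwinnertonDyer.BirchSwinnertonDyer.Theorems.…` (summit = sub)
set_option autoImplicit false

/-!
# Route `CongruentShaFreeCut` (rung S2) — LEMMA R WITHOUT THE SUPPLY HYPOTHESIS: value-at-𝟙 rigidity of the
# BDP frame (exact and up to a constant) over an imaginary quadratic field, AT EVERY PRIME `p`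

Cell `bsd-cn100`, prover seat `bsd-cn100-transfer` (g11); sibling of `CongruentShaFreeCutBDPUpToRigidity.lean`
(p477603: LEMMA R of MEMO-transfer-13 §5.4 for the ♯-frame, `[T⁰]L' = (C'/C)·[T⁰]L`, GIVEN the S27 character
supply) — here the supply binder is DISCHARGED by the cell's character-supply THEOREM
`…Theorems.CongruentShaFreeCutCharacterSupply.characterSupplyAt` (transfer g8, p442134; every prime `p`, `K`
imaginary quadratic, `κ` anticyclotomic, `γ` a topological generator; built on b2b-bsdres x11b3's
`X11b/InterpolationCharacterSupply` + `X11b/CharacterSupply`). So LEMMA R holds UNCONDITIONALLY in that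
setting, at `p = 2` included; the tree's supply-free S27 `…X11b.constantCoeff_eq_of_isBDPLFunction_of_isAnticyclotomic`
carries `p ≠ 2` — §1 removes it. Supports, does not close, stmt-BirchSwinnertonDyer-19079. THEOREMS ONLY (no
definition, no named fact, no `sorry`); imports no `Theses` module. HONEST FRAMING: elementary bookkeeping over
two landed theorems; nothing about (LB-exist♯), (LB-wan♯), crux A/B or BSD.

* §1 `constantCoeff_eq_of_isBDPLFunction` — S27 at EVERY prime: two EXACT frames `IsBDPLFunction ι 𝔭 κ γ f Ω_K Ω_p L`,
  `… Ω_K' Ω_p' L'` of the same `(ι, 𝔭, κ, γ, f)` over an imaginary quadratic `K` (`κ` anticyclotomic, `κ γ = 1`,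
  non-zero periods) have `[T⁰]L' = [T⁰]L` in `R₀`.
* §2 `coe_constantCoeff_eq_mul_of_isBDPLFunctionUpTo` — LEMMA R at EVERY prime, NO supply binder: two ♯-frames
  `IsBDPLFunctionUpTo C …L`, `IsBDPLFunctionUpTo C' … L'` (non-zero periods and constants) have
  `([T⁰]L' : ℂ_p) = (C'/C)·[T⁰]L`; `constantCoeff_eq_zero_iff_of_isBDPLFunctionUpTo` (`L(𝟙) = 0 ⟺ L'(𝟙) = 0`);
  `constantCoeff_eq_of_isBDPLFunctionUpTo` (`C' = C` ⟹ `[T⁰]L' = [T⁰]L`).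

The `p = 2` / `p = 3` READINGS onto the registered stubs with the supply discharged are s2b-c3 g7's
`CongruentShaFreeCutBDPUpToRigiditySupplied.lean` / `MordellShaFreeCutThreeAdicBDPValueRigiditySupplied.lean`
(not repeated here).

References: [Castella2018] Thm. 3.1–3.2 (arXiv:1704.06608 pp. 8–9); [CastellaHsieh2018] §3.3, Def. 3.5,
Prop. 3.6; [Washington1997] §13.1 and [Weil1956] §1–2 (the supply); [Cassels1986] Ch. 4.
-/

noncomputable section

open scoped Classical Topology

open Filter PowerSeries NumberField IsDedekindDomain Field
  Literature.NumberTheory.EllipticCurves Literature.NumberTheory.GaloisRepresentations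

namespace Summit.BirchSwinnertonDyer.BirchSwinnertonDyer.Theorems.CongruentShaFreeCutBDPUpToRigidity

open Summit.BirchSwinnertonDyer.Rank1Residual.X11b (constantCoeff_eq_of_isBDPLFunction_of_supply)
open Summit.BirchSwinnertonDyer.BirchSwinnertonDyer.Theorems.CongruentShaFreeCutCharacterSupply
  (characterSupplyAt)

variable {p : ℕ} [Fact p.Prime] {K : Type} [Field K] [NumberField K] {N : ℕ}
  {ι : PadicAlgCl p ≃+* ℂ} {𝔭 : HeightOneSpectrum (𝓞 K)} {κ : ZpExtension K p}
  {γ : Field.absoluteGaloisGroup K} {f : CuspForm (CongruenceSubgroup.Gamma0 N) 2}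
  {ΩK ΩK' : ℂ} {Ωp Ωp' C C' : ℂ_[p]} {L L' : UnrSeries p}

/-! ### §1 S27 at every prime: the exact frame -/

/-- **VALUE-AT-𝟙 RIGIDITY ACROSS PERIODS, EXACT FRAME, EVERY PRIME `p`** (b2b-bsdres S27
`…X11b.constantCoeff_eq_of_isBDPLFunction_of_supply` fed with the cell's supply theorem
`…CongruentShaFreeCutCharacterSupply.characterSupplyAt`; removes the `p ≠ 2` of
`…X11b.constantCoeff_eq_of_isBDPLFunction_of_isAnticyclotomic`): over an imaginary quadratic `K` with `κ`
anticyclotomic and `κ γ = 1`, two frames `IsBDPLFunction ι 𝔭 κ γ f Ω_K Ω_p L`, `IsBDPLFunction ι 𝔭 κ γ f Ω_K' Ω_p' L'`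
with non-zero periods have `[T⁰]L' = [T⁰]L`. [cite: Castella2018, Thm. 3.1–3.2 (arXiv:1704.06608 pp. 8–9) (interpolation shape; the rigidity statement is elementary p-adic analysis on R₀⟦T⟧)] -/
theorem constantCoeff_eq_of_isBDPLFunction (hK : IsImaginaryQuadratic K) (hκ : κ.IsAnticyclotomic)
    (hγ : κ.IsTopGenerator γ) (hΩK : ΩK ≠ 0) (hΩK' : ΩK' ≠ 0) (hΩp : Ωp ≠ 0) (hΩp' : Ωp' ≠ 0)
    (hL : IsBDPLFunction ι 𝔭 κ γ f ΩK Ωp L) (hL' : IsBDPLFunction ι 𝔭 κ γ f ΩK' Ωp' L') :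
    PowerSeries.constantCoeff L' = PowerSeries.constantCoeff L := by
  obtain ⟨m, x₀, φ, φ', r, r', hm, hx1, hx, hunr, hinf, hr, hrκ, hval, hunr', hinf', hr', hrκ', hval'⟩ :=
    characterSupplyAt (p := p) K ι κ γ hK hκ hγ
  exact constantCoeff_eq_of_isBDPLFunction_of_supply K N ι 𝔭 κ γ f ΩK ΩK' Ωp Ωp' L L' m x₀ φ φ' r r'
    hm hx1 hx hunr hinf hr hrκ hval hunr' hinf' hr' hrκ' hval' hΩK hΩK' hΩp hΩp' hL hL'

/-! ### §2 LEMMA R at every prime, no supply binder: the frame up to a constant -/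

/-- **LEMMA R (MEMO-transfer-13 §5.4) UNCONDITIONALLY over an imaginary quadratic field, EVERY PRIME `p`**:
for `IsBDPLFunctionUpTo C ι 𝔭 κ γ f Ω_K Ω_p L` and `IsBDPLFunctionUpTo C' ι 𝔭 κ γ f Ω_K' Ω_p' L'` (same
`ι, 𝔭, κ, γ, f`; `κ` anticyclotomic, `κ γ = 1`; `Ω_K, Ω_K', Ω_p, Ω_p', C, C'` non-zero):
`([T⁰]L' : ℂ_p) = (C'/C)·[T⁰]L` — `coe_constantCoeff_eq_mul_of_isBDPLFunctionUpTo_of_supply` (p477603) with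
its supply binder discharged by `characterSupplyAt`.
[cite: Castella2018, Thm. 3.1–3.2 (arXiv:1704.06608 pp. 8–9) (interpolation shape; the rigidity statement is elementary p-adic analysis on R₀⟦T⟧)]
[cite: CastellaHsieh2018, §3.3, Def. 3.5 and Prop. 3.6] -/
theorem coe_constantCoeff_eq_mul_of_isBDPLFunctionUpTo (hK : IsImaginaryQuadratic K)
    (hκ : κ.IsAnticyclotomic) (hγ : κ.IsTopGenerator γ) (hΩK : ΩK ≠ 0) (hΩK' : ΩK' ≠ 0) (hΩp : Ωp ≠ 0)
    (hΩp' : Ωp' ≠ 0) (hC : C ≠ 0) (hC' : C' ≠ 0) (hL : IsBDPLFunctionUpTo C ι 𝔭 κ γ f ΩK Ωp L)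
    (hL' : IsBDPLFunctionUpTo C' ι 𝔭 κ γ f ΩK' Ωp' L') :
    ((PowerSeries.constantCoeff L' : unrIntegers p) : ℂ_[p]) =
      C' / C * ((PowerSeries.constantCoeff L : unrIntegers p) : ℂ_[p]) := by
  obtain ⟨m, x₀, φ, φ', r, r', hm, -, hx, hunr, hinf, hr, hrκ, hval, hunr', hinf', hr', hrκ', hval'⟩ :=
    characterSupplyAt (p := p) K ι κ γ hK hκ hγ
  exact coe_constantCoeff_eq_mul_of_isBDPLFunctionUpTo_of_supply K N ι 𝔭 κ γ f ΩK ΩK' Ωp Ωp' C C' L L'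
    m x₀ φ φ' r r' hm hx hunr hinf hr hrκ hval hunr' hinf' hr' hrκ' hval' hΩK hΩK' hΩp hΩp' hC hC' hL hL'

/-- **`L(𝟙) = 0 ⟺ L'(𝟙) = 0`** for two ♯-frames over an imaginary quadratic field, every prime, no supply binder
(the memo's wording of LEMMA R). [cite: Castella2018, Thm. 3.1–3.2 (arXiv:1704.06608 pp. 8–9) (interpolation shape; the rigidity statement is elementary p-adic analysis on R₀⟦T⟧)] -/
theorem constantCoeff_eq_zero_iff_of_isBDPLFunctionUpTo (hK : IsImaginaryQuadratic K)
    (hκ : κ.IsAnticyclotomic) (hγ : κ.IsTopGenerator γ) (hΩK : ΩK ≠ 0) (hΩK' : ΩK' ≠ 0) (hΩp : Ωp ≠ 0)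
    (hΩp' : Ωp' ≠ 0) (hC : C ≠ 0) (hC' : C' ≠ 0) (hL : IsBDPLFunctionUpTo C ι 𝔭 κ γ f ΩK Ωp L)
    (hL' : IsBDPLFunctionUpTo C' ι 𝔭 κ γ f ΩK' Ωp' L') :
    PowerSeries.constantCoeff L = 0 ↔ PowerSeries.constantCoeff L' = 0 := by
  have key := coe_constantCoeff_eq_mul_of_isBDPLFunctionUpTo hK hκ hγ hΩK hΩK' hΩp hΩp' hC hC' hL hL'
  have e1 : PowerSeries.constantCoeff L = 0 ↔
      ((PowerSeries.constantCoeff L : unrIntegers p) : ℂ_[p]) = 0 := ZeroMemClass.coe_eq_zero.symm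
  have e2 : PowerSeries.constantCoeff L' = 0 ↔
      ((PowerSeries.constantCoeff L' : unrIntegers p) : ℂ_[p]) = 0 := ZeroMemClass.coe_eq_zero.symm
  rw [e1, e2, key, mul_eq_zero, or_iff_right (div_ne_zero hC' hC)]

/-- **`C' = C` ⟹ `[T⁰]L' = [T⁰]L` in `R₀`** for two ♯-frames over an imaginary quadratic field, every prime, no
supply binder. [cite: Castella2018, Thm. 3.1–3.2 (arXiv:1704.06608 pp. 8–9) (interpolation shape; the rigidity statement is elementary p-adic analysis on R₀⟦T⟧)] -/
theorem constantCoeff_eq_of_isBDPLFunctionUpTo (hK : IsImaginaryQuadratic K) (hκ : κ.IsAnticyclotomic)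
    (hγ : κ.IsTopGenerator γ) (hΩK : ΩK ≠ 0) (hΩK' : ΩK' ≠ 0) (hΩp : Ωp ≠ 0) (hΩp' : Ωp' ≠ 0)
    (hC : C ≠ 0) (hL : IsBDPLFunctionUpTo C ι 𝔭 κ γ f ΩK Ωp L)
    (hL' : IsBDPLFunctionUpTo C ι 𝔭 κ γ f ΩK' Ωp' L') :
    PowerSeries.constantCoeff L' = PowerSeries.constantCoeff L := by
  have key := coe_constantCoeff_eq_mul_of_isBDPLFunctionUpTo hK hκ hγ hΩK hΩK' hΩp hΩp' hC hC hL hL'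
  rw [div_self hC, one_mul] at key
  exact Subtype.ext key

end Summit.BirchSwinnertonDyer.BirchSwinnertonDyer.Theorems.CongruentShaFreeCutBDPUpToRigidity

end
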